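import Summits.HubbardSuperconductivity.HubbardSuperconductivity.Theorems.AnisotropyChordTransferFibre3RowCXParseval
import Summits.HubbardSuperconductivity.HubbardSuperconductivity.Theorems.AnisotropyChordTransferFibre3Cs2Bound
import Summits.HubbardSuperconductivity.HubbardSuperconductivity.Theorems.AnisotropyChordTransferFibre3RowCGmin
import Summits.HubbardSuperconductivity.HubbardSuperconductivity.Theorems.AnisotropyChordTransferFibre3RowCQ0Crude
import Summits.HubbardSuperconductivity.HubbardSuperconductivity.Theorems.AnisotropyChordTransferFibre3RowCDrops
import Summits.HubbardSuperconductivity.HubbardSuperconductivity.Theorems.AnisotropyChordTransferFibre3N1RowNamed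
import Summits.HubbardSuperconductivity.HubbardSuperconductivity.Theorems.AnisotropyChordTransferFibre3ManifoldA
import Summits.HubbardSuperconductivity.HubbardSuperconductivity.Theorems.AnisotropyChordTransferFibre3RowCChi
import Summits.HubbardSuperconductivity.HubbardSuperconductivity.Theorems.AnisotropyChordTransferFibre3RowCGmin64
import Summits.HubbardSuperconductivity.HubbardSuperconductivity.Theorems.AnisotropyChordTransferFibre3ManifoldA64

/-!
# Route `AnisotropyChord` / H0 rotor rung, row C (KT-2b) on the t-BLOCKS `64 ≤ L < 128`: block twin of `…AnisotropyChordTransferFibre3RowCChi`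

T-FORK (p1 g32, route-lead ruling R4-b; p2's inventory memo HOME/hubbard-h0-rotor-p2/TBLOCK-INVENTORY-g8.md §3–§4): the declarations of
`…RowCChi` that carry the hypothesis `128 ≤ L` (or a constant that changes below `L = 128`, or the `L2.NamedCell` cell box) restated in the
namespace `RowC.T` with the SAME names for the t-blocks (route-lead ruling R1): analytic layer with `64 ≤ L` and the `L ≥ 64` numerics of p2 g8
(`ManifoldA.nu_ceiling64` (ν < .0359), `manifold_band64`, `second_shell_window64` (±.0012/±.003), `RowC.fmax_uniform64`/`gmin_uniform64`
(same constant .07 + .1ν), `third_shell_window64` (±.0031/±.01), `window_k10_64` ([.24993, .25]), `lam_increment_bound64` (δ = .0022)); cell layer on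
block cells `c : L2.TCell` (`cellFinalBoxCB (c.box a₁ a₂)`, `pmem_xTrueT`, `RowC.finalVec_mem_of_cellFinalBoxT`).  Declarations that do not change are NOT
duplicated (they resolve to `RowC`); proofs are verbatim up to the substitutions.
Prover seat `hubbard-h0-rotor-p1` g32 (route lead); helper for piece A = stmt-HubbardSuperconductivity-23918 of rung 19089 (`--supports`, helper
class).  Nothing here proves superconductivity in the Hubbard model; lemmas for ONE row of ONE conditional reduction on the t-blocks; the rotor TARGET
as originally worded stays FALSE (g15 verdict).  Mathlib + the tree only; no sorry.
-/

set_option linter.dupNamespace false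
set_option autoImplicit false

noncomputable section

open scoped BigOperators

namespace Summit.HubbardSuperconductivity.HubbardSuperconductivity.Theorems.AnisotropyChord.Transfer.Fibre3

namespace RowC

namespace T

variable (L : ℕ) [NeZero L]

section ingredients

variable {L}

variable (hL : 64 ≤ L) {Δ lam2 : ℝ} {f : Tor L → ℝ} (hΔ0 : 0 ≤ Δ) (hΔ1 : Δ < 1) (hf : IsGroundTwoMagnon L Δ lam2 f)

include hL hΔ0 hΔ1 hf


/-- the dictionary in the cell variables: `η = etaN ν`, `c_s = csN`, `f(x̂) = fnnN`, `V = 4π²/t`. [folklore] -/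
theorem dict_N :
    etaEff L lam2 = etaN (lam2 / (2 * Real.pi / L) ^ 2) ∧
    cS L Δ lam2 f = csN ((2 * Real.pi / L) ^ 2) (lam2 / (2 * Real.pi / L) ^ 2) (Δ * f (K1 L)) ∧
    f (K1 L) = fnnN (lam2 / (2 * Real.pi / L) ^ 2) (Δ * f (K1 L)) ∧
    ((L : ℝ) ^ 2) = 4 * Real.pi ^ 2 / (2 * Real.pi / L) ^ 2 := by
  have hL5 : 5 ≤ L := by omega
  have hL0 : (0 : ℝ) < L := by exact_mod_cast (show 0 < L by omega)
  have hπ := Real.pi_pos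
  have ht0 : 0 < (2 * Real.pi / L) ^ 2 := by positivity
  have hV : ((L : ℝ) ^ 2) = 4 * Real.pi ^ 2 / (2 * Real.pi / L) ^ 2 := by field_simp; ring
  obtain ⟨d1, d2, _, _, _, _, d7⟩ := ManifoldA.manifold_dictionary L hL5 hΔ0 hΔ1 hf
  have hη : etaEff L lam2 = etaN (lam2 / (2 * Real.pi / L) ^ 2) := by rw [d7]; unfold etaN; ring
  refine ⟨hη, ?_, ?_, hV⟩
  · rw [d2, hη]; unfold csN; rw [hV]; field_simp
  · unfold fnnN; rw [← hη]; linarith [d1]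


/-- the uniform `M`: `|f| ≤ MN t ν a`. [folklore] -/
theorem abs_f_le_MN (r : Tor L) :
    |f r| ≤ MN ((2 * Real.pi / L) ^ 2) (lam2 / (2 * Real.pi / L) ^ 2) (Δ * f (K1 L)) := by
  have hL0 : (0 : ℝ) < L := by exact_mod_cast (show 0 < L by omega)
  have hπ := Real.pi_pos
  have ht0 : 0 < (2 * Real.pi / L) ^ 2 := by positivity
  obtain ⟨_, hcs, _, hV⟩ := dict_N hL hΔ0 hΔ1 hf
  have hνle : lam2 ≤ 0.0513 * (2 * Real.pi / L) ^ 2 := by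
    have h := ManifoldA.nu_ceiling64 L hL hΔ0 hf
    have : 0.0359 * (2 * Real.pi / L) ^ 2 ≤ 0.0513 * (2 * Real.pi / L) ^ 2 := by nlinarith [ht0.le]
    linarith
  have h := fmax_uniform64 L hL hΔ0 hΔ1 hf hνle r
  unfold MN
  rw [← hcs]
  have e : Δ * f (K1 L) / (L : ℝ) ^ 2 = Δ * f (K1 L) * (2 * Real.pi / L) ^ 2 / (4 * Real.pi ^ 2) := by
    rw [hV]; field_simp
  rw [← e]
  exact h


/-- `t·‖s‖² = ts2N`. [folklore] -/
theorem t_sNormSq_eq :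
    (2 * Real.pi / L) ^ 2 * sNormSq L Δ f
      = ts2N ((2 * Real.pi / L) ^ 2) (lam2 / (2 * Real.pi / L) ^ 2) (Δ * f (K1 L))
          (((2 * Real.pi / L) ^ 2) ^ 2 * S2n L lam2) := by
  have hL5 : 5 ≤ L := by omega
  have hL0 : (0 : ℝ) < L := by exact_mod_cast (show 0 < L by omega)
  have hπ := Real.pi_pos
  have ht0 : 0 < (2 * Real.pi / L) ^ 2 := by positivity
  obtain ⟨_, hcs, _, hV⟩ := dict_N hL hΔ0 hΔ1 hf
  have hs2 := sNormNamed_holds L hL5 hΔ0 lam2 f hf (lam2_pos L (by omega) hΔ1 hf.1)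
  unfold dPar at hs2
  rw [hs2, hcs, hV]; unfold ts2N; field_simp


/-- `Q₀ ≤ tQ0N/t`. [folklore] -/
theorem Q0_le_tQ0N :
    Q0 L f ≤ tQ0N ((2 * Real.pi / L) ^ 2) (lam2 / (2 * Real.pi / L) ^ 2) (Δ * f (K1 L))
      (((2 * Real.pi / L) ^ 2) ^ 2 * S2n L lam2) / (2 * Real.pi / L) ^ 2 := by
  have hL5 : 5 ≤ L := by omega
  have hL0 : (0 : ℝ) < L := by exact_mod_cast (show 0 < L by omega)
  have hπ := Real.pi_pos
  have ht0 : 0 < (2 * Real.pi / L) ^ 2 := by positivity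
  obtain ⟨_, _, _, hV⟩ := dict_N hL hΔ0 hΔ1 hf
  have hts2 := t_sNormSq_eq hL hΔ0 hΔ1 hf
  obtain ⟨_, _, hq⟩ := q0Crude_holds L Δ lam2 f hL5 hΔ0 hΔ1 hf
  rw [sum_erase_sfun_sq L Δ f] at hq
  rw [le_div_iff₀ ht0]
  set t := (2 * Real.pi / L) ^ 2 with ht
  set a := Δ * f (K1 L) with ha
  have e2 : 2 * a / (L : ℝ) ^ 2 = a * t / (2 * Real.pi ^ 2) := by rw [hV]; field_simp; ring
  rw [e2] at hq
  have := mul_le_mul_of_nonneg_right hq ht0.le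
  have e3 : ((L : ℝ) ^ 2 + 3 + (6 + 4 * (1 - a + a * t / (2 * Real.pi ^ 2)) + (1 - a + a * t / (2 * Real.pi ^ 2)) ^ 2)
      * (sNormSq L Δ f - (1 - a) ^ 2)) * t
      = 4 * Real.pi ^ 2 + 3 * t + (6 + 4 * (1 - a + a * t / (2 * Real.pi ^ 2)) + (1 - a + a * t / (2 * Real.pi ^ 2)) ^ 2)
        * (t * sNormSq L Δ f - t * (1 - a) ^ 2) := by rw [hV]; field_simp
  rw [e3, hts2] at this
  unfold tQ0N sigN
  exact this


/-- `R̄ = RbN`. [folklore] -/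
theorem Rbar_eq_RbN :
    Rbar L Δ f = RbN ((2 * Real.pi / L) ^ 2) (lam2 / (2 * Real.pi / L) ^ 2) (Δ * f (K1 L))
      (((2 * Real.pi / L) ^ 2) ^ 2 * S2n L lam2) := by
  have hL3 : 3 ≤ L := by omega
  have hL0 : (0 : ℝ) < L := by exact_mod_cast (show 0 < L by omega)
  have hπ := Real.pi_pos
  have ht0 : 0 < (2 * Real.pi / L) ^ 2 := by positivity
  obtain ⟨hη, _, _, hV⟩ := dict_N hL hΔ0 hΔ1 hf
  have hts2 := t_sNormSq_eq hL hΔ0 hΔ1 hf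
  have hgrad := gradSNormClosed_holds L hL3 Δ lam2 f hf (ex L) (ex_mem_nnList L)
  rw [rbarClosed_holds L Δ lam2 f hL3 hf]
  have : gradNormSq L Δ f = ∑ r : Tor L, Dgrad L (sfun' L Δ f) (ex L) r ^ 2 := rfl
  have hsn : ∑ r : Tor L, sfun' L Δ f r ^ 2 = sNormSq L Δ f := rfl
  rw [hsn] at hgrad
  rw [this, hgrad, hη]
  unfold RbN tauN
  rw [hV, ← hts2]
  field_simp


/-- `X ≤ XN` (`XSn ≤ xs`). [folklore] -/
theorem Xmom_le_XN (xs : ℝ) (hxs : XSn L lam2 ≤ xs) :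
    Xmom L Δ f ≤ XN ((2 * Real.pi / L) ^ 2) (lam2 / (2 * Real.pi / L) ^ 2) (Δ * f (K1 L))
      (eps1 L / (2 * Real.pi / L) ^ 2) xs := by
  have hL5 : 5 ≤ L := by omega
  have hL0 : (0 : ℝ) < L := by exact_mod_cast (show 0 < L by omega)
  have hπ := Real.pi_pos
  have ht0 : 0 < (2 * Real.pi / L) ^ 2 := by positivity
  obtain ⟨hη, hcs, _, _⟩ := dict_N hL hΔ0 hΔ1 hf
  rw [xmom_eq_XSn L hL5 hΔ0 hf, hcs, hη]
  unfold XN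
  have hc2 : 0 ≤ csN ((2 * Real.pi / L) ^ 2) (lam2 / (2 * Real.pi / L) ^ 2) (Δ * f (K1 L)) ^ 2 := sq_nonneg _
  have h1 := mul_le_mul_of_nonneg_left hxs hc2
  have h8 : (0 : ℝ) < 8 * Real.pi ^ 2 := by positivity
  have h2 := div_le_div_of_nonneg_right h1 h8.le
  have e : etaN (lam2 / (2 * Real.pi / L) ^ 2) ^ 2 * (eps1 L / (2 * Real.pi / L) ^ 2) * (2 * Real.pi / L) ^ 2
      = etaN (lam2 / (2 * Real.pi / L) ^ 2) ^ 2 * eps1 L := by field_simp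
  rw [e]
  linarith


end ingredients


/-! ## The bound -/


/-- ★★ **THE `cs2` INPUT IN NORMALISED CLOSED FORM** (`L ≥ 128`, ground profile, `0 ≤ Δ < 1`, `XSn ≤ xs`). [folklore] -/
theorem cs2_le_ChiN (hL : 64 ≤ L) {Δ lam2 : ℝ} {f : Tor L → ℝ} (hΔ0 : 0 ≤ Δ) (hΔ1 : Δ < 1)
    (hf : IsGroundTwoMagnon L Δ lam2 f) (xs : ℝ) (hxs : XSn L lam2 ≤ xs) :
    cs2 L f ≤ ChiN ((2 * Real.pi / L) ^ 2) (lam2 / (2 * Real.pi / L) ^ 2) (Δ * f (K1 L))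
      (eps1 L / (2 * Real.pi / L) ^ 2) (((2 * Real.pi / L) ^ 2) ^ 2 * S2n L lam2) xs := by
  have hL2 : 2 ≤ L := by omega
  have hL0 : (0 : ℝ) < L := by exact_mod_cast (show 0 < L by omega)
  have hπ := Real.pi_pos
  set t : ℝ := (2 * Real.pi / L) ^ 2 with ht
  have ht0 : 0 < t := by positivity
  set ν : ℝ := lam2 / t with hν
  set a : ℝ := Δ * f (K1 L) with ha
  set e1 : ℝ := eps1 L / t with he1
  set x4 : ℝ := t ^ 2 * S2n L lam2 with hx4
  have heps : eps1 L = e1 * t := by rw [he1]; field_simp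
  obtain ⟨_, _, hfnn, _⟩ := dict_N hL hΔ0 hΔ1 hf
  rw [← ht, ← hν, ← ha] at hfnn
  have hmirror : ∀ r : Tor L, f (-r.1, r.2) = f r := ground_mirror L hL2 hf
  have hM := abs_f_le_MN hL hΔ0 hΔ1 hf
  have hcs2 := cs2RealSpaceBound_holds L Δ lam2 (MN t ν a) f hf.1 hmirror hM
  have hQ0 := Q0_le_tQ0N hL hΔ0 hΔ1 hf
  have hRbar := Rbar_eq_RbN hL hΔ0 hΔ1 hf
  have hX := Xmom_le_XN hL hΔ0 hΔ1 hf xs hxs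
  rw [← ht, ← hν, ← ha] at hQ0 hRbar hX
  rw [← hx4] at hQ0 hRbar
  rw [← he1] at hX
  have hGam : GammaM L Δ f (MN t ν a) = GamN t ν a x4 := by
    unfold GammaM GamN; rw [hRbar, hfnn]
  -- nonnegativity
  have hX0 := Xmom_nonneg L Δ f
  have hR0 := Rbar_nonneg L Δ f
  have hQ00 := Q0_nonneg L f
  have hΓ0 : 0 ≤ GammaM L Δ f (MN t ν a) := by
    unfold GammaM; have := sq_nonneg (f (K1 L)); positivity
  have hε0 : 0 ≤ eps1 L := (eps1_pos L (by omega)).le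
  -- monotone replacement `Q₀ ↦ tQ0N/t`, `X ↦ XN`
  set Q0h : ℝ := tQ0N t ν a x4 / t with hQ0h
  have hQ0h0 : 0 ≤ Q0h := le_trans hQ00 hQ0
  have hXN0 : 0 ≤ XN t ν a e1 xs := le_trans hX0 hX
  have m1 : 4 * eps1 L * Q0 L f * Xmom L Δ f ≤ 4 * eps1 L * Q0h * XN t ν a e1 xs := by
    have := mul_le_mul hQ0 hX hX0 hQ0h0
    have h4 : 0 ≤ 4 * eps1 L := by positivity
    calc 4 * eps1 L * Q0 L f * Xmom L Δ f = 4 * eps1 L * (Q0 L f * Xmom L Δ f) := by ring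
      _ ≤ 4 * eps1 L * (Q0h * XN t ν a e1 xs) := mul_le_mul_of_nonneg_left this h4
      _ = 4 * eps1 L * Q0h * XN t ν a e1 xs := by ring
  have hGR : 0 ≤ GammaM L Δ f (MN t ν a) * Rbar L Δ f := mul_nonneg hΓ0 hR0
  have m2 : Real.sqrt (4 * Q0 L f * Xmom L Δ f * (GammaM L Δ f (MN t ν a) * Rbar L Δ f))
      ≤ Real.sqrt (4 * Q0h * XN t ν a e1 xs * (GammaM L Δ f (MN t ν a) * Rbar L Δ f)) := by
    apply Real.sqrt_le_sqrt
    have := mul_le_mul hQ0 hX hX0 hQ0h0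
    have := mul_le_mul_of_nonneg_right this hGR
    linarith
  have hstep : cs2 L f ≤ 4 * eps1 L * Q0h * XN t ν a e1 xs
      + eps1 L * Rbar L Δ f * (GammaM L Δ f (MN t ν a) + 2 * f (K1 L) ^ 2 * MN t ν a ^ 2)
      + 2 * eps1 L * Real.sqrt (4 * Q0h * XN t ν a e1 xs * (GammaM L Δ f (MN t ν a) * Rbar L Δ f)) := by
    have := mul_le_mul_of_nonneg_left m2 (by positivity : (0 : ℝ) ≤ 2 * eps1 L)
    linarith [hcs2, m1]
  refine hstep.trans (le_of_eq ?_)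
  -- the algebra: `ε₁ = e₁ t`, `Q0h = tQ0N/t`, `√(…)` with `t²` pulled out
  rw [hRbar, hGam, hfnn, heps, hQ0h]
  unfold ChiN
  have hsq : Real.sqrt (4 * (tQ0N t ν a x4 / t) * XN t ν a e1 xs * (GamN t ν a x4 * RbN t ν a x4))
      = Real.sqrt (4 * t * tQ0N t ν a x4 * XN t ν a e1 xs * GamN t ν a x4 * RbN t ν a x4) / t := by
    rw [eq_div_iff ht0.ne', ← Real.sqrt_sq ht0.le, ← Real.sqrt_mul' _ (sq_nonneg t), Real.sqrt_sq ht0.le]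
    congr 1
    field_simp
  rw [hsq]
  field_simp


end T

end RowC

end Summit.HubbardSuperconductivity.HubbardSuperconductivity.Theorems.AnisotropyChord.Transfer.Fibre3

end
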